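import Mathlib
import HarnessLib
import Summits.QuantumFields.YangMills.Theses.ScalingWindowSplit
import Summits.QuantumFields.YangMills.Theorems.SelfNormalisedMomentBoundsR.Negative.SelfNormalisedMomentBoundsRFalseOfTwoScaleHonestWindowScheme
import Summits.QuantumFields.YangMills.Theorems.ScalingWindowSplitSelfNormalisedMomentBoundsROfClusterBoundSlack

/-!
# `SelfNormalisedMomentBoundsR` (stmt-QuantumFields-18014) — negative lemma, SEQUENCE FORM of the second scale

Companion of `SelfNormalisedMomentBoundsRFalseOfTwoScaleHonestWindowScheme.lean` (same directory, line lead `Sketch`,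
gen 1).  The hypothesis `TwoScaleHonestWindowScheme` (`H₂`) of that negative lemma is an `∀ s B, ∃ᶠ k, ∃ (v, w)` statement;
whoever INHABITS it (the intended inhabitant is the masked product group `U(1) × SU(2)`, see that file's module docstring)
will do so with ONE explicit sequence of disjoint pairs — bumps of width `ρ_k = (log β_k)⁻²` at mutual distance `3ρ_k` —
whose normalised bare truncated two-point function diverges against the reference pair at EVERY Schwartz order.  This file
records that sequence form as the hypothesis `TwoScaleSequenceScheme` (`H₂^seq`), proves `H₂^seq → H₂`
(`twoScaleHonestWindowScheme_of_tendsto`, `twoScale_of_twoScaleSequence`: the floor makes the denominator positive on the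
tail, "eventually `≥ B + 1`" gives "`> B`", eventually implies frequently), and the negative lemma BY NAME
`SelfNormalisedMomentBoundsR_false_of_TwoScaleSequenceScheme : H₂^seq → ¬ SelfNormalisedMomentBoundsR`.

Why `H₂^seq` is not constructible here: as for `H₂` — (P1) Coulomb control of Wilson-`U(1)₄` plaquette covariances at large
`β` in volumes exponential in `β`; (P2a) the weak-coupling mass gap of `SU(2)₄` with the asymptotic-freedom bound on the
correlation length; (P2b) running-coupling control of the `tr F²` two-point function in the perturbative window.  Repair
proposed to the planner: U_RS (`IsCompactSimpleLieGroup G →`).  No `sorry`; axioms `propext`, `Classical.choice`, `Quot.sound`.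
-/

noncomputable section

open scoped SchwartzMap BigOperators Topology
open MeasureTheory Filter Topology
open Literature.MathematicalPhysics.AQFT Literature.MathematicalPhysics.QuantumLattice
open Literature.MathematicalPhysics.QuantumFieldTheory

namespace Summit.QuantumFields.YangMills.Theorems.SelfNormalisedMomentBoundsR.Negative

section Inhabit

variable {G : Type} [Group G] [TopologicalSpace G] [IsTopologicalGroup G] [CompactSpace G]
  [MeasurableSpace G] [BorelSpace G]

/-- **`H₂` from ONE sequence of disjoint pairs with diverging normalised ratio.**  At an admissible datum of U_R
(weak coupling, polynomial volumes, past-supported `u`, floor and window), if some sequence of real pairs `(v_k, w_k)` with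
disjoint supports has, for EVERY Schwartz order `s`,
`|T⁰_k(v_k, w_k)| / ((|v_k|_s + 1)(|w_k|_s + 1) · T⁰_k(u,θu)) → ∞`, then `TwoScaleHonestWindowScheme` holds: the floor makes
the denominator positive on the tail, so "eventually `≥ B + 1`" gives "`> B`" there, and eventually implies frequently.
[folklore] -/
theorem twoScaleHonestWindowScheme_of_tendsto
    (r : LatticeRep G) (sch : SpeciesScheme (YMSpecies G))
    (u : 𝓢(EuclideanSpace ℝ (Fin 4), ℝ)) (p : ℕ) (M : ℝ)
    (v w : ℕ → 𝓢(EuclideanSpace ℝ (Fin 4), ℝ)) :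
    let bare : SpeciesScheme (YMSpecies G) := { sch with c := fun _ _ => 1, m := fun _ _ => 0 }
    let T : 𝓢(EuclideanSpace ℝ (Fin 4), ℝ) → ℕ → ℝ := fun w k =>
      latticeSchwinger r.ρ bare (fun s => s.F) k (1 + 1) (fun _ => r.curvature) ![w, thetaTest 4 w] -
        latticeSchwinger r.ρ bare (fun s => s.F) k 1 (fun _ => r.curvature) ![w] *
          latticeSchwinger r.ρ bare (fun s => s.F) k 1 (fun _ => r.curvature) ![thetaTest 4 w]
    let T₂ : 𝓢(EuclideanSpace ℝ (Fin 4), ℝ) → 𝓢(EuclideanSpace ℝ (Fin 4), ℝ) → ℕ → ℝ := fun v w k =>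
      latticeSchwinger r.ρ bare (fun s => s.F) k (1 + 1) (fun _ => r.curvature) ![v, w] -
        latticeSchwinger r.ρ bare (fun s => s.F) k 1 (fun _ => r.curvature) ![v] *
          latticeSchwinger r.ρ bare (fun s => s.F) k 1 (fun _ => r.curvature) ![w]
    sch.HasWeakCouplingLimit →
    (∃ N : ℕ, 1 ≤ N ∧ ∀ᶠ k in Filter.atTop, (sch.a k)⁻¹ ≤ (sch.a k * (sch.L k : ℝ)) ^ N) →
    tsupport u ⊆ {y : EuclideanSpace ℝ (Fin 4) | y 0 < 0} →
    (∀ᶠ k in Filter.atTop, (sch.a k) ^ p ≤ T u k ∧ T u k ≤ M * T (timeShiftTest 4 (-1) u) k) →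
    (∀ k, Disjoint (tsupport (v k)) (tsupport (w k))) →
    (∀ s : ℕ, Tendsto (fun k => |T₂ (v k) (w k) k| /
        ((schwartzNorm s (ofRealTest (v k)) + 1) * (schwartzNorm s (ofRealTest (w k)) + 1) * T u k))
        Filter.atTop Filter.atTop) →
    TwoScaleHonestWindowScheme := by
  intro bare T T₂ hw hpv hu hfw hdisj hdiv
  refine ⟨G, inferInstance, inferInstance, inferInstance, inferInstance, inferInstance, inferInstance,
    r, sch, u, p, M, hw, hpv, hu, hfw, fun s B => ?_⟩
  have hev : ∀ᶠ k in Filter.atTop, B * (schwartzNorm s (ofRealTest (v k)) + 1) *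
      (schwartzNorm s (ofRealTest (w k)) + 1) * T u k < |T₂ (v k) (w k) k| := by
    filter_upwards [hfw, (hdiv s).eventually_ge_atTop (B + 1)] with k hk hge
    have hTpos : 0 < T u k := (pow_pos (sch.a_pos k) p).trans_le hk.1
    have hD : 0 < (schwartzNorm s (ofRealTest (v k)) + 1) * (schwartzNorm s (ofRealTest (w k)) + 1) * T u k :=
      mul_pos (mul_pos (by linarith [schwartzNorm_nonneg s (ofRealTest (v k))])
        (by linarith [schwartzNorm_nonneg s (ofRealTest (w k))])) hTpos
    rw [le_div_iff₀ hD] at hge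
    calc B * (schwartzNorm s (ofRealTest (v k)) + 1) * (schwartzNorm s (ofRealTest (w k)) + 1) * T u k
          = B * ((schwartzNorm s (ofRealTest (v k)) + 1) * (schwartzNorm s (ofRealTest (w k)) + 1) * T u k) := by
            ring
      _ < (B + 1) * ((schwartzNorm s (ofRealTest (v k)) + 1) * (schwartzNorm s (ofRealTest (w k)) + 1) * T u k) :=
            mul_lt_mul_of_pos_right (lt_add_one B) hD
      _ ≤ |T₂ (v k) (w k) k| := hge
  exact (hev.mono fun k hk => ⟨v k, w k, hdisj k, hk⟩).frequently

end Inhabit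

/-- **`H₂^seq` — a TWO-SCALE SEQUENCE SCHEME** (hypothesis of this negative lemma; not constructible in the tree): an
admissible datum of U_R (compact `G`, faithful `r`, Wilson scheme `sch` at weak coupling with polynomial volumes,
past-supported bump `u`, floor and window at `u`) together with ONE sequence of real pairs `(v_k, w_k)` with disjoint
supports whose bare truncated two-point function, normalised by the Schwartz sizes of ANY fixed order `s`, diverges
against the reference pair: `|T⁰_k(v_k,w_k)| / ((|v_k|_s+1)(|w_k|_s+1) T⁰_k(u,θu)) → ∞` for every `s`.  Intended
inhabitant: `U(1) × SU(2)`, `r = e^{iθ} ⊕ V`, `a_k = ρ_k/ξ_{SU(2)}(2β_k)`, `ρ_k = (log β_k)⁻²`, `v_k, w_k` bumps of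
width `ρ_k` at mutual distance `3ρ_k` away from the hyperplane (ratio `≍ β_k² g_eff(ρ_k)⁴ ρ_k^{2s} → ∞` for every `s`),
conditionally on (P1)+(P2a)+(P2b) of the module docstring.  A HYPOTHESIS (no citation tag on purpose). -/
def TwoScaleSequenceScheme : Prop :=
  ∃ (G : Type) (_ : Group G) (_ : TopologicalSpace G) (_ : IsTopologicalGroup G) (_ : CompactSpace G)
    (_ : MeasurableSpace G) (_ : BorelSpace G) (r : LatticeRep G) (sch : SpeciesScheme (YMSpecies G))
    (u : 𝓢(EuclideanSpace ℝ (Fin 4), ℝ)) (p : ℕ) (M : ℝ) (v w : ℕ → 𝓢(EuclideanSpace ℝ (Fin 4), ℝ)),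
    let bare : SpeciesScheme (YMSpecies G) := { sch with c := fun _ _ => 1, m := fun _ _ => 0 }
    let T : 𝓢(EuclideanSpace ℝ (Fin 4), ℝ) → ℕ → ℝ := fun w k =>
      latticeSchwinger r.ρ bare (fun s => s.F) k (1 + 1) (fun _ => r.curvature) ![w, thetaTest 4 w] -
        latticeSchwinger r.ρ bare (fun s => s.F) k 1 (fun _ => r.curvature) ![w] *
          latticeSchwinger r.ρ bare (fun s => s.F) k 1 (fun _ => r.curvature) ![thetaTest 4 w]
    let T₂ : 𝓢(EuclideanSpace ℝ (Fin 4), ℝ) → 𝓢(EuclideanSpace ℝ (Fin 4), ℝ) → ℕ → ℝ := fun v w k =>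
      latticeSchwinger r.ρ bare (fun s => s.F) k (1 + 1) (fun _ => r.curvature) ![v, w] -
        latticeSchwinger r.ρ bare (fun s => s.F) k 1 (fun _ => r.curvature) ![v] *
          latticeSchwinger r.ρ bare (fun s => s.F) k 1 (fun _ => r.curvature) ![w]
    sch.HasWeakCouplingLimit ∧
    (∃ N : ℕ, 1 ≤ N ∧ ∀ᶠ k in Filter.atTop, (sch.a k)⁻¹ ≤ (sch.a k * (sch.L k : ℝ)) ^ N) ∧
    tsupport u ⊆ {y : EuclideanSpace ℝ (Fin 4) | y 0 < 0} ∧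
    (∀ᶠ k in Filter.atTop, (sch.a k) ^ p ≤ T u k ∧ T u k ≤ M * T (timeShiftTest 4 (-1) u) k) ∧
    (∀ k, Disjoint (tsupport (v k)) (tsupport (w k))) ∧
    ∀ s : ℕ, Tendsto (fun k => |T₂ (v k) (w k) k| /
        ((schwartzNorm s (ofRealTest (v k)) + 1) * (schwartzNorm s (ofRealTest (w k)) + 1) * T u k))
        Filter.atTop Filter.atTop

/-- **`H₂^seq ⊆ H₂`.** [folklore] -/
theorem twoScale_of_twoScaleSequence (h : TwoScaleSequenceScheme) : TwoScaleHonestWindowScheme := by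
  obtain ⟨G, _, _, _, _, _, _, r, sch, u, p, M, v, w, hw, hpv, hu, hfw, hdisj, hdiv⟩ := h
  exact twoScaleHonestWindowScheme_of_tendsto r sch u p M v w hw hpv hu hfw hdisj hdiv

/-- **Negative lemma modulo `H₂^seq`: a two-scale sequence scheme refutes U_R as typed** —
`TwoScaleSequenceScheme → ¬ SelfNormalisedMomentBoundsR`, through `H₂^seq ⊆ H₂` and the scale-rigidity negative lemma
`SelfNormalisedMomentBoundsR_false_of_TwoScaleHonestWindowScheme`.  Class (on paper): refuted-MISSTATED; repair U_RS
(`IsCompactSimpleLieGroup G →`), which the masked-product-group witness pattern misses. [folklore] -/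
theorem SelfNormalisedMomentBoundsR_false_of_TwoScaleSequenceScheme :
    TwoScaleSequenceScheme →
      ¬ Summit.QuantumFields.YangMills.Theses.ScalingWindowSplit.SelfNormalisedMomentBoundsR :=
  fun h => SelfNormalisedMomentBoundsR_false_of_TwoScaleHonestWindowScheme (twoScale_of_twoScaleSequence h)

/-! ## The RESHAPED physics stub of line `Sketch` inherits the refutation (appended, gen 1) -/

/-- **The slackened cluster bound for ALL compact `G` is refuted by a two-scale honest-window scheme.**  The reshaped
registered stub `stub_clusterBoundSlack` of line `Sketch` (per-leg kernel `(a d)⁻⁴ (1 + a d)`, stated inline as the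
hypothesis of the landed `selfNormalisedMomentBoundsR_of_clusterBoundSlack`) implies U_R, hence
`TwoScaleHonestWindowScheme` refutes it — the long-distance slack repairs the stub for asymptotically free simple `G`, not
the SHORT-distance masked-sector enhancement of a product group; after the restate the honest target is the same stub with
`IsCompactSimpleLieGroup G →`. [folklore] -/
theorem clusterBoundSlack_false_of_TwoScaleHonestWindowScheme (h : TwoScaleHonestWindowScheme) :
    ¬ (∀ (G : Type) [Group G] [TopologicalSpace G] [IsTopologicalGroup G] [CompactSpace G] [MeasurableSpace G]
      [BorelSpace G] (r : LatticeRep G) (sch : SpeciesScheme (YMSpecies G)) (u : 𝓢(EuclideanSpace ℝ (Fin 4), ℝ))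
      (p : ℕ) (M : ℝ),
      let bare : SpeciesScheme (YMSpecies G) := { sch with c := fun _ _ => 1, m := fun _ _ => 0 }
      let T : 𝓢(EuclideanSpace ℝ (Fin 4), ℝ) → ℕ → ℝ := fun w k =>
        latticeSchwinger r.ρ bare (fun s => s.F) k (1 + 1) (fun _ => r.curvature) ![w, thetaTest 4 w] -
          latticeSchwinger r.ρ bare (fun s => s.F) k 1 (fun _ => r.curvature) ![w] *
            latticeSchwinger r.ρ bare (fun s => s.F) k 1 (fun _ => r.curvature) ![thetaTest 4 w]
      let canon : SpeciesScheme (YMSpecies G) :=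
        { sch with
          c := fun _ k => (Real.sqrt (T u k))⁻¹
          m := fun _ k => ∫ U, r.curvature.F (torusLift (sch.side k) U) ∂(wilsonMeasure r.ρ (sch.β k)) }
      sch.HasWeakCouplingLimit →
      (∃ N : ℕ, 1 ≤ N ∧ ∀ᶠ k in atTop, (sch.a k)⁻¹ ≤ (sch.a k * (sch.L k : ℝ)) ^ N) →
      tsupport u ⊆ {y : EuclideanSpace ℝ (Fin 4) | y 0 < 0} →
      (∀ᶠ k in atTop, (sch.a k) ^ p ≤ T u k ∧ T u k ≤ M * T (timeShiftTest 4 (-1) u) k) →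
      ∃ (C : ℝ) (k₀ : ℕ), 1 ≤ C ∧ ∀ k : ℕ, k₀ ≤ k →
        ∀ (n : ℕ) (x : Fin n → Literature.Probability.LatticeModels.Site 4)
          (q : Fin n → Summit.QuantumFields.YangMills.Cruxes.HypercubicLimit.CouplingResponse.Plane),
          2 ≤ n → Function.Injective x →
          (∀ i, x i ∈ Literature.Probability.LatticeModels.box 4 (canon.L k)) →
          |canon.c r.curvature k ^ n *
              ∫ U, ∏ i, ((Summit.QuantumFields.YangMills.Cruxes.HypercubicLimit.CouplingResponse.planeSpecies r (q i)).F
                (configShift (-(x i)) (torusLift (canon.side k) U)) - canon.m r.curvature k / 6)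
                ∂(Summit.QuantumFields.YangMills.Cruxes.HypercubicLimit.CouplingResponse.wilsonAt r canon k)| ≤
            C ^ n * ∑ f : Fin n → Fin n, (if ∀ i, f i ≠ i then
              ∏ i, (((canon.a k * ‖siteToE (fun μ : Fin 4 =>
                ((((x i μ - x (f i) μ : ℤ) : ZMod (canon.side k)).valMinAbs : ℤ)))‖)⁻¹) ^ 4 *
                (1 + canon.a k * ‖siteToE (fun μ : Fin 4 =>
                  ((((x i μ - x (f i) μ : ℤ) : ZMod (canon.side k)).valMinAbs : ℤ)))‖)) else 0)) :=
  fun hcb => SelfNormalisedMomentBoundsR_false_of_TwoScaleHonestWindowScheme h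
    (Summit.QuantumFields.YangMills.Theorems.ScalingWindowSplit.SelfNormalisedMomentBoundsR.selfNormalisedMomentBoundsR_of_clusterBoundSlack
      hcb)

end Summit.QuantumFields.YangMills.Theorems.SelfNormalisedMomentBoundsR.Negative

end
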